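import Summits.BirchSwinnertonDyer.BirchSwinnertonDyer.Theorems.KolyvaginDepthDoorDepthTableSteinWuthrichRankThree22481a1
import HarnessLib

/-!
# Route `KolyvaginDepthDoor`, crux `KolyvaginDepthSupplyKN` (stmt-BirchSwinnertonDyer-22820) —
# DEPTH TABLE v14 (part 6): `22481a1` at the RANK-ZERO Heegner field `d_K = −8`

Helper file of the lead prover of line `levelone` (kdd-p1 g18; `--supports stmt-BirchSwinnertonDyer-22820
--as helper`); it closes nothing and BSD is NOT proved by it.

Sequel of `KolyvaginDepthDoorDepthTableSteinWuthrichRankThree{,11197a1,…,12279a1}` (the nine rank-3 atlas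
curves in the v13 / exact currency). The point of the odd-rank rows is that the Heegner twist has EVEN analytic rank, so
at a field with `L(E^{(d_K)}, 1) ≠ 0` the closing datum is the `5`-part of BSD of a RANK-ZERO curve. At the
lineage's field of record `d_K = −7` this holds (numerically, context only — no proof depends on it) for eight of
the nine curves: `L(E^{(−7)},1) ≈ 4.48, 5.30, 5.25, 4.10, 7.22, 6.59` (`5077a1`, `11197a1`, `16811a1`, `18097b1`,
`11642a1`, `13766a1`), `L(E^{(−8)},1) ≈ 4.28` (`21443a1`), `L(E^{(−47)},1) ≈ 3.18` (`12279a1`) — but NOT for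
`22481a1`, whose twist by `−7` has `L(E^{(−7)}, 1) = 0` to the precision computed (even order `≥ 2`: a rank-two
twist of conductor `1 101 569`, outside every table). The next Heegner field of `22481a1` (`N = 22481` prime,
`22481 ≡ 1 (mod 8)`) is `d_K = −8`, where `L(E^{(−8)}, 1) ≈ 5.98 ≠ 0`. This file supplies that field:

* `C22481a1.heegner_neg8` — the Heegner hypothesis for `22481` at `d_K = −8` (kernel: `(−8/22481) = 1`).
* `C22481a1.cruxBody_of_twistSelmer_neg8` — the CLAUSE of `KolyvaginDepthSupplyKN` at `22481a1` VERBATIM from ONE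
  bound `#Sel_5(E^{(−8)}/ℚ) ≤ 5³` (SW Thm. 1.1 + W. Zhang L8.4 (1) by name; `5` inert in `ℚ(√−2)`), whose expected
  closing datum is `Sel_5(E^{(−8)}/ℚ) = 0` — rank-zero.

CONDITIONAL on the named print facts Stein–Wuthrich 2013 Thm. 1.1 and W. Zhang 2014 Lemma 8.4 (1) / Thm. 9.1;
per curve; nothing class-wide; BSD is NOT proved by any of this. The `L`-values quoted are double-precision sums
`2 Σ a_n χ_d(n) n⁻¹ e^{−2πn/√(N d²)}` (`n ≤ 12 000`), recorded as context for the kit, not as tree facts.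

References: [SteinWuthrich2013] Thm. 1.1 (p. 1758); [WZhang2014] Lemma 8.4 (1) (p. 236), Thm. 9.1 (p. 240);
[CremonaAlgorithms1997] Table 1 (22481a1); [Marcus1977] Ch. 3 Thm. 25.
-/

set_option linter.dupNamespace false

noncomputable section

open scoped Classical NumberField

namespace Summit.BirchSwinnertonDyer.BirchSwinnertonDyer.Theorems.KolyvaginDepthDoor

open Literature.NumberTheory.EllipticCurves Literature.NumberTheory.EllipticCurves.ModularForms
  WeierstrassCurve NumberField IsDedekindDomain
open Summit.BirchSwinnertonDyer.BirchSwinnertonDyer.Theorems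
open Summit.BirchSwinnertonDyer.BirchSwinnertonDyer.Rank2Observatory
open Summit.BirchSwinnertonDyer.BirchSwinnertonDyer.Rank1Residual
open Summit.BirchSwinnertonDyer.Rank1Residual.Additive

namespace C22481a1

/-- **Heegner data `d_K = -8` for `22481a1`**: the only prime of `Δ = ±22481` splits in a quadratic field of
discriminant `-8` (Kronecker symbol `= 1`). [cite: Marcus1977, Ch. 3 Thm. 25] [cite: GrossLMS1991, §1] -/
theorem heegner_neg8 : ∀ q : ℕ, q.Prime → (q : ℤ) ∣ (⟨1, -1, 1, 6, 2⟩ : WeierstrassCurve ℤ).Δ →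
    (q = 2 → (-8 : ℤ) % 8 = 1) ∧ (q ≠ 2 → jacobiSym (-8) q = 1) :=
  forall_prime_dvd_of_natAbs_eq_pow (a := 22481) (i := 1) (by decide +kernel) (by norm_num)
    ⟨by norm_num, by norm_num⟩

/-- **THE CRUX `KolyvaginDepthSupplyKN` AT THE RANK-THREE CURVE `22481a1`, MODULO ONE TWIST `5`-SELMER
BOUND.** Granted the two named print facts (Stein–Wuthrich 2013 Thm. 1.1; W. Zhang 2014 Lemma 8.4 (1) /
Thm. 9.1) and, for ONE imaginary quadratic `K` with `d_K = -8`, the bound `#Sel_5(E^{(d_K)}/ℚ) ≤ 5³` on the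
Heegner twist, the CLAUSE of the crux holds at `W = 22481a1` VERBATIM: witnesses `p = 5` (good ordinary
`goodOrdinary_5`, `ρ_{E,5^∞}` onto `hasSurjectiveModNGaloisRep_pow_5`, Kodaira–Néron and ♠ from `|Δ(E₀)| = 22481`),
that `K` (Heegner `heegner_neg8`; `5 ∤ 8`, `5` inert in `K`), W. Zhang's level-one class, first sign `ν + 1 ≤ rank`
(`5³ ≤ 5^rank` from `three_le_rank`). The twist `E^{(-8)}` has EVEN analytic rank (odd rank `3`, Heegner `K`):
where `L(E^{(-8)}, 1) ≠ 0` the expected closing datum is `Sel_5(E^{(-8)}/ℚ) = 0`, a RANK-ZERO datum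
(`cruxBody_of_twistSelmer_trivial_of_steinWuthrich`, part 1). `L(E^{(−8)}, 1) ≈ 5.98 ≠ 0` numerically: the rank-zero field. CONDITIONAL on the two named facts and the one
twist datum; per curve (the open stub (S♭) is untouched); BSD is not proved by it.
[cite: SteinWuthrich2013, Thm. 1.1 (p. 1758)] [cite: WZhang2014, Lemma 8.4 (1) (p. 236), Thm. 9.1 (p. 240)]
[cite: CremonaAlgorithms1997, Table 1 (22481a1)] -/
theorem cruxBody_of_twistSelmer_neg8
    (hSW : SteinWuthrich2013_sha_inf_torsionBy_eq_bot_of_two_le_rank)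
    (h84 : Literature.NumberTheory.EllipticCurves.WZhang2014_lemma84_exists_minimal_kolyvaginClass_one_selmerCard)
    (K : Type) [Field K] [NumberField K] (hK : IsImaginaryQuadratic K)
    (hD : NumberField.discr K = -8)
    (hT : haveI := isElliptic_of_mem_atlasR3A00 mem_atlas;
      Nat.card (((c22481a1.e.baseChange ℚ).quadraticTwist (NumberField.discr K : ℚ)).selmerGroup (5 : ℕ)) ≤
        5 ^ 3) :
    haveI := isElliptic_of_mem_atlasR3A00 mem_atlas;
    haveI := isGloballyMinimal_of_mem_atlasR3A00 mem_atlas;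
    ∃ (p : ℕ) (hp : Fact p.Prime), 5 ≤ p ∧ (c22481a1.e.baseChange ℚ).HasGoodReductionAtPrime p ∧
      ¬ (p : ℤ) ∣ (c22481a1.e.baseChange ℚ).frobeniusTrace p ∧
      (∀ n : ℕ, (c22481a1.e.baseChange ℚ).HasSurjectiveModNGaloisRep (p ^ n : ℕ)) ∧
      (∀ v : HeightOneSpectrum (𝓞 ℚ), (c22481a1.e.baseChange ℚ).HasMultiplicativeReductionAt v →
        ¬ p ∣ (c22481a1.e.baseChange ℚ).ordMinimalDiscriminant v) ∧
      ∃ (K : Type) (_ : Field K) (_ : NumberField K), IsImaginaryQuadratic K ∧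
        NumberField.discr K ≠ -3 ∧ NumberField.discr K ≠ -4 ∧
        ∃ (_ : NeZero ((c22481a1.e.baseChange ℚ).conductorNorm ℤ)),
          SatisfiesHeegnerHypothesis ((c22481a1.e.baseChange ℚ).conductorNorm ℤ) K ∧
        ∃ (Dt : ModularParametrizationData (c22481a1.e.baseChange ℚ) ((c22481a1.e.baseChange ℚ).conductorNorm ℤ))
          (β : ℤ) (ι : K →+* ℂ) (n₁ : ℕ) (d : KolyvaginHeegnerData Dt β ι n₁), Squarefree n₁ ∧
          (∀ q ∈ n₁.primeFactors,
            Zhang2014.IsKolyvaginPrime ((c22481a1.e.baseChange ℚ).conductorNorm ℤ) (c22481a1.e.baseChange ℚ) K p q) ∧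
          d.kolyvaginClass hp.out 1 ≠ 0 ∧
          (n₁.primeFactors.card + 1 ≤ (c22481a1.e.baseChange ℚ).mordellWeilRank ∨
            (n₁.primeFactors.card ≤ (c22481a1.e.baseChange ℚ).mordellWeilRank ∧
              n₁.primeFactors.card + 1 ≤
                ((c22481a1.e.baseChange ℚ).quadraticTwist (NumberField.discr K : ℚ)).mordellWeilRank)) := by
  haveI := isElliptic_of_mem_atlasR3A00 mem_atlas
  haveI := isGloballyMinimal_of_mem_atlasR3A00 mem_atlas
  haveI iNZ : NeZero ((c22481a1.e.baseChange ℚ).conductorNorm ℤ) := neZero_conductorNorm_of_isElliptic _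
  haveI i5 := Fact.mk (by norm_num : Nat.Prime 5)
  have hsp := spade_5
  have hKN : ∀ v : HeightOneSpectrum (𝓞 ℚ), (c22481a1.e.baseChange ℚ).HasMultiplicativeReductionAt v →
      ¬ 5 ∣ (c22481a1.e.baseChange ℚ).ordMinimalDiscriminant v :=
    not_dvd_ordMinimalDiscriminant_of_intModel_table intModel (p := 5) (Δ₀ := -22481) (by decide +kernel)
      (B := 8) (by decide +kernel) (by decide +kernel)
  have hS2 : ¬ Squarefree ((c22481a1.e.baseChange ℚ).conductorNorm ℤ) →
      (∃ (ℓ : ℕ) (_ : Fact ℓ.Prime), (c22481a1.e.baseChange ℚ).HasMultiplicativeReductionAtPrime ℓ ∧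
          ¬ 5 ∣ padicValInt ℓ (c22481a1.e.baseChange ℚ).minimalDiscriminantInt) ∧
        ∃ (ℓ₁ ℓ₂ : ℕ) (_ : Fact ℓ₁.Prime) (_ : Fact ℓ₂.Prime), ℓ₁ ≠ ℓ₂ ∧
          (c22481a1.e.baseChange ℚ).HasMultiplicativeReductionAtPrime ℓ₁ ∧
            (c22481a1.e.baseChange ℚ).HasMultiplicativeReductionAtPrime ℓ₂ :=
    fun hns ↦ absurd ((c22481a1.e.baseChange ℚ).isSemistable_iff_squarefree_conductorNorm.mp hsp.2) hns
  have hH := satisfiesHeegnerHypothesis_conductorNorm_of_intModel intModel K hK.1 hD heegner_neg8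
  have hD3 : NumberField.discr K ≠ -3 := by rw [hD]; norm_num
  have hD4 : NumberField.discr K ≠ -4 := by rw [hD]; norm_num
  have hpD : ¬ (((5 : ℕ) : ℤ) ∣ NumberField.discr K) := by rw [hD]; norm_num
  have hr3 : 3 ≤ (c22481a1.e.baseChange ℚ).mordellWeilRank := three_le_rank
  have hT' : Nat.card (((c22481a1.e.baseChange ℚ).quadraticTwist (NumberField.discr K : ℚ)).selmerGroup (5 : ℕ)) ≤
      5 ^ (c22481a1.e.baseChange ℚ).mordellWeilRank :=
    le_trans hT (Nat.pow_le_pow_right (by norm_num) hr3)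
  exact cruxBody_of_twistSelmer_of_steinWuthrich hSW h84 _ not_hasCM (le_trans (by norm_num) hr3)
    (by rw [conductorNorm_eq]; norm_num) 5 (by norm_num) (by norm_num) goodOrdinary_5.1 goodOrdinary_5.2
    hasSurjectiveModNGaloisRep_pow_5 hKN hsp.1 hS2 K hK hD3 hD4 hpD hH hT'


/-- **EXACT READING OF THE CRUX AT `22481a1`, `(p, d_K) = (5, -8)` — the `∃`-body ⟺ THE TWIST CONDITION ALONE.**
For `E = 22481a1` (rank `3`, ♠ cell, `5` admissible) and ANY imaginary quadratic `K` with `d_K = -8`: «∃ frame,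
square-free product `n₁` of Kolyvagin primes, datum: `c_1(n₁) ≠ 0` ∧ the signed rank clause» (the body of
`KolyvaginDepthSupplyKN` at `(E, 5, K)`) `↔` «`#Sel_5(E^{(d_K)}/ℚ) ≤ 5^{rank E}` ∨ (`Ш(E^{(d_K)}/ℚ)[5] = 0` ∧
`rank E^{(d_K)} = rank E + 1`)» — the lineage's exact reading on the ♠ cell
(`kolyvaginClass_rankClause_iff_shaTrivial_twistCondition_of_lemma84`, g14) with its `E`-side conjunct `Ш(E)[5] = 0`
DISCHARGED by Stein–Wuthrich Thm. 1.1 (`sha_inf_torsionBy_five_eq_bot`): at this odd-rank curve the crux's content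
is a statement about ONE quadratic twist of even analytic rank and nothing else. CONDITIONAL on (γ), W. Zhang L8.4 (1) /
9.1 and SW Thm. 1.1 by name; per curve; BSD is not proved by it. [cite: SteinWuthrich2013, Thm. 1.1 (p. 1758)]
[cite: WZhang2014, Lemma 8.4 (1) (p. 236), Thm. 9.1 (p. 240)] [cite: GrossLMS1991, Prop. 3.7 (2)] [cite: SilvermanAEC2009, Thm. X.4.2] -/
theorem exactBody_5_neg8_iff_twistCondition
    (hSW : SteinWuthrich2013_sha_inf_torsionBy_eq_bot_of_two_le_rank)
    (h372 : GrossLMS1991.prop37_2_frobeniusCongruence)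
    (h84 : Literature.NumberTheory.EllipticCurves.WZhang2014_lemma84_exists_minimal_kolyvaginClass_one_selmerCard)
    (K : Type) [Field K] [NumberField K] (hK : IsImaginaryQuadratic K)
    (hD : NumberField.discr K = -8) :
    haveI := isElliptic_of_mem_atlasR3A00 mem_atlas;
    haveI := isGloballyMinimal_of_mem_atlasR3A00 mem_atlas;
    haveI : NeZero ((c22481a1.e.baseChange ℚ).conductorNorm ℤ) := neZero_conductorNorm_of_isElliptic _;
    haveI := Fact.mk (by norm_num : Nat.Prime 5);
    (∃ (Dt : ModularParametrizationData (c22481a1.e.baseChange ℚ) ((c22481a1.e.baseChange ℚ).conductorNorm ℤ)) (β : ℤ) (ι : K →+* ℂ) (n₁ : ℕ)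
      (d : KolyvaginHeegnerData Dt β ι n₁), Squarefree n₁ ∧
        (∀ q ∈ n₁.primeFactors, Zhang2014.IsKolyvaginPrime ((c22481a1.e.baseChange ℚ).conductorNorm ℤ) (c22481a1.e.baseChange ℚ) K 5 q) ∧
        d.kolyvaginClass (p := 5) (by norm_num) 1 ≠ 0 ∧
        (n₁.primeFactors.card + 1 ≤ (c22481a1.e.baseChange ℚ).mordellWeilRank ∨
          (n₁.primeFactors.card ≤ (c22481a1.e.baseChange ℚ).mordellWeilRank ∧
            n₁.primeFactors.card + 1 ≤ ((c22481a1.e.baseChange ℚ).quadraticTwist (NumberField.discr K : ℚ)).mordellWeilRank))) ↔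
    (Nat.card (((c22481a1.e.baseChange ℚ).quadraticTwist (NumberField.discr K : ℚ)).selmerGroup (5 : ℕ)) ≤ 5 ^ (c22481a1.e.baseChange ℚ).mordellWeilRank ∨
      ((((c22481a1.e.baseChange ℚ).quadraticTwist (NumberField.discr K : ℚ)).sha ⊓
          AddSubgroup.torsionBy ((c22481a1.e.baseChange ℚ).quadraticTwist (NumberField.discr K : ℚ)).galH1 ((5 : ℕ) : ℤ) :
          AddSubgroup ((c22481a1.e.baseChange ℚ).quadraticTwist (NumberField.discr K : ℚ)).galH1) = ⊥ ∧
        ((c22481a1.e.baseChange ℚ).quadraticTwist (NumberField.discr K : ℚ)).mordellWeilRank = (c22481a1.e.baseChange ℚ).mordellWeilRank + 1)) := by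
  haveI := isElliptic_of_mem_atlasR3A00 mem_atlas
  haveI := isGloballyMinimal_of_mem_atlasR3A00 mem_atlas
  haveI iNZ : NeZero ((c22481a1.e.baseChange ℚ).conductorNorm ℤ) := neZero_conductorNorm_of_isElliptic _
  haveI i5 := Fact.mk (by norm_num : Nat.Prime 5)
  have hsp := spade_5
  have hKN : ∀ v : HeightOneSpectrum (𝓞 ℚ), (c22481a1.e.baseChange ℚ).HasMultiplicativeReductionAt v →
      ¬ 5 ∣ (c22481a1.e.baseChange ℚ).ordMinimalDiscriminant v :=
    not_dvd_ordMinimalDiscriminant_of_intModel_table intModel (p := 5) (Δ₀ := -22481) (by decide +kernel)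
      (B := 8) (by decide +kernel) (by decide +kernel)
  have hS2 : ¬ Squarefree ((c22481a1.e.baseChange ℚ).conductorNorm ℤ) →
      (∃ (ℓ : ℕ) (_ : Fact ℓ.Prime), (c22481a1.e.baseChange ℚ).HasMultiplicativeReductionAtPrime ℓ ∧
          ¬ 5 ∣ padicValInt ℓ (c22481a1.e.baseChange ℚ).minimalDiscriminantInt) ∧
        ∃ (ℓ₁ ℓ₂ : ℕ) (_ : Fact ℓ₁.Prime) (_ : Fact ℓ₂.Prime), ℓ₁ ≠ ℓ₂ ∧
          (c22481a1.e.baseChange ℚ).HasMultiplicativeReductionAtPrime ℓ₁ ∧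
            (c22481a1.e.baseChange ℚ).HasMultiplicativeReductionAtPrime ℓ₂ :=
    fun hns ↦ absurd ((c22481a1.e.baseChange ℚ).isSemistable_iff_squarefree_conductorNorm.mp hsp.2) hns
  have hH := satisfiesHeegnerHypothesis_conductorNorm_of_intModel intModel K hK.1 hD heegner_neg8
  have hD3 : NumberField.discr K ≠ -3 := by rw [hD]; norm_num
  have hD4 : NumberField.discr K ≠ -4 := by rw [hD]; norm_num
  have hpD : ¬ (((5 : ℕ) : ℤ) ∣ NumberField.discr K) := by rw [hD]; norm_num
  have hr3 : 3 ≤ (c22481a1.e.baseChange ℚ).mordellWeilRank := three_le_rank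
  exact (kolyvaginClass_rankClause_iff_shaTrivial_twistCondition_of_lemma84 h372 h84 _ not_hasCM 5 (by norm_num)
    goodOrdinary_5.1 goodOrdinary_5.2 hasSurjectiveModNGaloisRep_pow_5 hKN hsp.1 hS2 K hK hD3 hD4 hpD hH).trans
    (and_iff_right (sha_inf_torsionBy_five_eq_bot hSW))

/-- **DEPTH-TABLE ROW `22481a1`, `(p, d_K) = (5, -8)`, at depth `rank − 1`, v14 — «ONE BIT ⟺ ONE TWIST-SELMER BOUND».**
For `E = 22481a1` and ANY imaginary quadratic `K` with `d_K = -8`: «∃ frame, square-free product `n₁` of `rank E − 1`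
Kolyvagin primes, datum: `c_1(n₁) ≠ 0`» `↔` «`#Sel_5(E^{(d_K)}/ℚ) ≤ 5^{rank E − 1}`» — the lineage's depth row on
the ♠ cell (`kolyvaginClass_depth_ne_zero_iff_shaTrivial_twistSelmer_of_lemma84`, g14) with `Ш(E)[5] = 0` DISCHARGED by
SW Thm. 1.1. With `rank E = 3` (the tree holds `3 ≤ rank`) the bit a depth-`2` computation would find is EXACTLY
«`dim_𝔽₅ Sel_5(E^{(d_K)}) ≤ 2`»; for a twist of analytic rank `0` (no `5`-torsion: `E^{(d)}[5]` is irreducible)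
that is «`#Ш(E^{(d_K)}/ℚ)[5] ≤ 25`». CONDITIONAL on (γ), W. Zhang L8.4 (1) / 9.1 and SW Thm. 1.1 by name; per curve;
BSD is not proved by it. [cite: SteinWuthrich2013, Thm. 1.1 (p. 1758)] [cite: WZhang2014, Lemma 8.4 (1) (p. 236)]
[cite: GrossLMS1991, Prop. 3.7 (2), §5 (5.1)] [cite: Kolyvagin1991MathAnn, Thm. 2.3] -/
theorem exactRowDepth_5_neg8_iff_twistSelmer
    (hSW : SteinWuthrich2013_sha_inf_torsionBy_eq_bot_of_two_le_rank)
    (h372 : GrossLMS1991.prop37_2_frobeniusCongruence)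
    (h84 : Literature.NumberTheory.EllipticCurves.WZhang2014_lemma84_exists_minimal_kolyvaginClass_one_selmerCard)
    (K : Type) [Field K] [NumberField K] (hK : IsImaginaryQuadratic K)
    (hD : NumberField.discr K = -8) :
    haveI := isElliptic_of_mem_atlasR3A00 mem_atlas;
    haveI := isGloballyMinimal_of_mem_atlasR3A00 mem_atlas;
    haveI : NeZero ((c22481a1.e.baseChange ℚ).conductorNorm ℤ) := neZero_conductorNorm_of_isElliptic _;
    haveI := Fact.mk (by norm_num : Nat.Prime 5);
    (∃ (Dt : ModularParametrizationData (c22481a1.e.baseChange ℚ) ((c22481a1.e.baseChange ℚ).conductorNorm ℤ)) (β : ℤ) (ι : K →+* ℂ) (n₁ : ℕ)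
      (d : KolyvaginHeegnerData Dt β ι n₁), Squarefree n₁ ∧
        (∀ q ∈ n₁.primeFactors, Zhang2014.IsKolyvaginPrime ((c22481a1.e.baseChange ℚ).conductorNorm ℤ) (c22481a1.e.baseChange ℚ) K 5 q) ∧
        n₁.primeFactors.card + 1 = (c22481a1.e.baseChange ℚ).mordellWeilRank ∧ d.kolyvaginClass (p := 5) (by norm_num) 1 ≠ 0) ↔
    Nat.card (((c22481a1.e.baseChange ℚ).quadraticTwist (NumberField.discr K : ℚ)).selmerGroup (5 : ℕ)) ≤
      5 ^ ((c22481a1.e.baseChange ℚ).mordellWeilRank - 1) := by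
  haveI := isElliptic_of_mem_atlasR3A00 mem_atlas
  haveI := isGloballyMinimal_of_mem_atlasR3A00 mem_atlas
  haveI iNZ : NeZero ((c22481a1.e.baseChange ℚ).conductorNorm ℤ) := neZero_conductorNorm_of_isElliptic _
  haveI i5 := Fact.mk (by norm_num : Nat.Prime 5)
  have hsp := spade_5
  have hKN : ∀ v : HeightOneSpectrum (𝓞 ℚ), (c22481a1.e.baseChange ℚ).HasMultiplicativeReductionAt v →
      ¬ 5 ∣ (c22481a1.e.baseChange ℚ).ordMinimalDiscriminant v :=
    not_dvd_ordMinimalDiscriminant_of_intModel_table intModel (p := 5) (Δ₀ := -22481) (by decide +kernel)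
      (B := 8) (by decide +kernel) (by decide +kernel)
  have hS2 : ¬ Squarefree ((c22481a1.e.baseChange ℚ).conductorNorm ℤ) →
      (∃ (ℓ : ℕ) (_ : Fact ℓ.Prime), (c22481a1.e.baseChange ℚ).HasMultiplicativeReductionAtPrime ℓ ∧
          ¬ 5 ∣ padicValInt ℓ (c22481a1.e.baseChange ℚ).minimalDiscriminantInt) ∧
        ∃ (ℓ₁ ℓ₂ : ℕ) (_ : Fact ℓ₁.Prime) (_ : Fact ℓ₂.Prime), ℓ₁ ≠ ℓ₂ ∧
          (c22481a1.e.baseChange ℚ).HasMultiplicativeReductionAtPrime ℓ₁ ∧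
            (c22481a1.e.baseChange ℚ).HasMultiplicativeReductionAtPrime ℓ₂ :=
    fun hns ↦ absurd ((c22481a1.e.baseChange ℚ).isSemistable_iff_squarefree_conductorNorm.mp hsp.2) hns
  have hH := satisfiesHeegnerHypothesis_conductorNorm_of_intModel intModel K hK.1 hD heegner_neg8
  have hD3 : NumberField.discr K ≠ -3 := by rw [hD]; norm_num
  have hD4 : NumberField.discr K ≠ -4 := by rw [hD]; norm_num
  have hpD : ¬ (((5 : ℕ) : ℤ) ∣ NumberField.discr K) := by rw [hD]; norm_num
  have hr3 : 3 ≤ (c22481a1.e.baseChange ℚ).mordellWeilRank := three_le_rank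
  exact (kolyvaginClass_depth_ne_zero_iff_shaTrivial_twistSelmer_of_lemma84 h372 h84 _ not_hasCM 5 (by norm_num)
    goodOrdinary_5.1 goodOrdinary_5.2 hasSurjectiveModNGaloisRep_pow_5 hKN hsp.1 hS2 K hK hD3 hD4 hpD hH
    (le_trans (by norm_num) hr3)).trans
    (and_iff_right (sha_inf_torsionBy_five_eq_bot hSW))

end C22481a1

end Summit.BirchSwinnertonDyer.BirchSwinnertonDyer.Theorems.KolyvaginDepthDoor

end
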